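import Literature.ModelTheory.Zilber.EACAperiodicBase
import HarnessLib

/-!
# The density lift, III: rank bookkeeping for rotundity

Zilber's Exponential-Algebraic Closedness, case ladder (host summit Schanuel, cell `pub-schanuel`,
seat 2, gen 6).  Generic tools for verifying rotundity `rk M ≤ dim [M]·V` of a variety
`V = Z(P) ∩ Gⁿ` from transcendence degrees at a generic point (Bays–Kirby 2018, proof of Prop. 7.3),
used by `ZilberEacDensityLiftRotund` for the density lift `W_e(S)`:

* `rank_le_zariskiDim_image_matrixAct_of_det_ne_zero` — FULL RANK: if `det M ≠ 0` then
  `dim [M]·V = dim V = n ≥ rk M` (every coordinate of the generic point is algebraic over `F[[M] ξ]`,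
  `isAlgebraic_of_det_ne_zero`; extracted verbatim from the proof of
  `isRotund_zeroLocus_of_not_hasIntegerPeriod`);
* `rank_map_lt_of_det_eq_zero`, `ne_zero_of_rank_map_pos`, `exists_row_not_smul_of_two_le_rank` —
  the shape of an integer matrix of rank `0 < r < n`: some row is nonzero, and if `r ≥ 2` no row
  spans all rows over `ℚ`;
* `algebraicIndependent_pair` — `{a, b}` is algebraically independent iff `a` is transcendental
  and `b` is transcendental over `F[a]` (Mathlib's `AlgebraicIndependent.option_iff`, reindexed);
* `transcendental_add_mul_of_transcendental` — `r + c·u` is transcendental over a subring `R ∋ r`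
  when `u` is and `c ∈ F^×`.

Elementary linear algebra / field theory; no EAC content.
-/

noncomputable section

open MvPolynomial
open Literature.NumberTheory.Transcendental Literature.ModelTheory.Zilber

set_option linter.dupNamespace false

universe u

namespace Summit.Schanuel.Schanuel.Theorems

/-! ## Full rank: `dim [M]·V = dim V` -/

/-- **Full-rank matrices act without dropping dimension**: for a prime `P` of `F[X, Y]` with
`Z(P) ∩ Gⁿ ≠ ∅` and `dim Z(P) = n`, and `M ∈ Mₙ(ℤ)` with `det M ≠ 0`, `rk M ≤ dim [M](Z(P) ∩ Gⁿ)`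
(indeed `dim [M]·V = n`: every coordinate of a generic point `ξ` is algebraic over `F[[M] ξ]`).
[cite: BaysKirby2018ANT, Prop. 7.3 (proof)] -/
theorem rank_le_zariskiDim_image_matrixAct_of_det_ne_zero {F : Type u} [Field F] [IsAlgClosed F]
    [CharZero F] {n : ℕ} (P : Ideal (MvPolynomial (Fin n ⊕ Fin n) F)) [P.IsPrime]
    (hne : (zeroLocus F P ∩ torusLocus F n).Nonempty) (hdim : zariskiDim F (zeroLocus F P) = n)
    (M : Matrix (Fin n) (Fin n) ℤ) (hdet : M.det ≠ 0) :
    (((M.map (Int.cast : ℤ → ℚ)).rank : ℕ) : WithBot ℕ∞) ≤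
      zariskiDim F (matrixAct M '' (zeroLocus F P ∩ torusLocus F n)) := by
  classical
  have hξ : IsGenericPt P (genericPt P) := isGenericPt_genericPt P
  have hξT : genericPt P ∈ torusLocus (zeroLocusFunctionField P) n :=
    genericPt_mem_torusLocus P (X_inr_notMem_of_nonempty P hne)
  have hdetE : ((M.det : ℤ) : zeroLocusFunctionField P) ≠ 0 := by
    rw [← map_intCast (algebraMap F (zeroLocusFunctionField P))]
    refine (map_ne_zero_iff _ (algebraMap F (zeroLocusFunctionField P)).injective).2 ?_
    exact_mod_cast hdet
  have hrk : (((M.map (Int.cast : ℤ → ℚ)).rank : ℕ) : WithBot ℕ∞) ≤ ((n : ℕ) : WithBot ℕ∞) := by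
    exact_mod_cast (M.map (Int.cast : ℤ → ℚ)).rank_le_width
  refine hrk.trans ?_
  have h1 : zariskiDim F (matrixAct (1 : Matrix (Fin n) (Fin n) ℤ) ''
      (zeroLocus F P ∩ torusLocus F n)) = zariskiDim F (zeroLocus F P) := by
    have himg : matrixAct (1 : Matrix (Fin n) (Fin n) ℤ) '' (zeroLocus F P ∩ torusLocus F n) =
        zeroLocus F P ∩ torusLocus F n := by
      ext z
      simp only [Set.mem_image, matrixAct_one, exists_eq_right]
    rw [himg, zariskiDim, zariskiDim, vanishingIdeal_zeroLocus_inter_torusLocus P hne,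
      MvPolynomial.IsPrime.vanishingIdeal_zeroLocus (K := F) P]
  rw [zariskiDim_image_matrixAct_eq P hξ hne 1, hdim, matrixAct_one] at h1
  rw [zariskiDim_image_matrixAct_eq P hξ hne M, ← h1]
  have hle : Algebra.trdeg F (aeval (genericPt P) :
        MvPolynomial (Fin n ⊕ Fin n) F →ₐ[F] zeroLocusFunctionField P).range ≤
      Algebra.trdeg F (aeval (matrixAct M (genericPt P)) :
        MvPolynomial (Fin n ⊕ Fin n) F →ₐ[F] zeroLocusFunctionField P).range := by
    rw [← Algebra.adjoin_range_eq_range_aeval, ← Algebra.adjoin_range_eq_range_aeval]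
    exact Literature.RingTheory.NoetherNormalization.trdeg_adjoin_le_trdeg_adjoin_of_forall_isAlgebraic
      (by
        rintro _ ⟨i, rfl⟩
        exact isAlgebraic_of_det_ne_zero hξT M hdetE i)
  have hfin : Algebra.trdeg F (aeval (matrixAct M (genericPt P)) :
        MvPolynomial (Fin n ⊕ Fin n) F →ₐ[F] zeroLocusFunctionField P).range < Cardinal.aleph0 := by
    haveI : Algebra.FiniteType F (aeval (matrixAct M (genericPt P)) :
        MvPolynomial (Fin n ⊕ Fin n) F →ₐ[F] zeroLocusFunctionField P).range :=
      Algebra.FiniteType.of_surjective (aeval (matrixAct M (genericPt P))).rangeRestrict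
        (AlgHom.rangeRestrict_surjective _)
    rw [Literature.RingTheory.KrullDimension.trdeg_eq_toNat F]
    exact Cardinal.natCast_lt_aleph0
  exact_mod_cast Cardinal.toNat_le_toNat hle hfin

/-! ## Rank of an integer matrix over `ℚ` -/

/-- A singular integer matrix has rank `< n` over `ℚ`. [folklore] -/
theorem rank_map_lt_of_det_eq_zero {n : ℕ} (M : Matrix (Fin n) (Fin n) ℤ) (hdet : M.det = 0) :
    (M.map (Int.cast : ℤ → ℚ)).rank < n := by
  classical
  set A := M.map (Int.cast : ℤ → ℚ) with hA
  have hdetA : A.det = 0 := by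
    have := RingHom.map_det (Int.castRingHom ℚ) M
    rw [hdet, map_zero] at this
    rw [hA]
    exact this.symm
  obtain ⟨v, hv, hAv⟩ := Matrix.exists_mulVec_eq_zero_iff.2 hdetA
  have hker : LinearMap.ker A.mulVecLin ≠ ⊥ := by
    intro h
    apply hv
    have : v ∈ LinearMap.ker A.mulVecLin := by
      rw [LinearMap.mem_ker, Matrix.mulVecLin_apply, hAv]
    rw [h] at this
    exact (Submodule.mem_bot ℚ).1 this
  have hsum := LinearMap.finrank_range_add_finrank_ker A.mulVecLin
  rw [Module.finrank_fin_fun] at hsum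
  have hk : Module.finrank ℚ (LinearMap.ker A.mulVecLin) ≠ 0 := by
    rwa [Ne, Submodule.finrank_eq_zero]
  unfold Matrix.rank
  omega

/-- A matrix of positive rank is nonzero. [folklore] -/
theorem ne_zero_of_rank_map_pos {n : ℕ} (M : Matrix (Fin n) (Fin n) ℤ)
    (h : 0 < (M.map (Int.cast : ℤ → ℚ)).rank) : M ≠ 0 := by
  rintro rfl
  have h0 : (0 : Matrix (Fin n) (Fin n) ℤ).map (Int.cast : ℤ → ℚ) = 0 := by
    ext i j
    simp
  rw [h0, Matrix.rank_zero] at h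
  exact lt_irrefl 0 h

/-- **Rank `≥ 2` ⇒ no row spans the rows**: for every row `i₀` some row is not a rational multiple
of it. [folklore] -/
theorem exists_row_not_smul_of_two_le_rank {n : ℕ} (M : Matrix (Fin n) (Fin n) ℤ)
    (h : 2 ≤ (M.map (Int.cast : ℤ → ℚ)).rank) (i₀ : Fin n) :
    ∃ i₁ : Fin n, ∀ t : ℚ, (M.map (Int.cast : ℤ → ℚ)) i₁ ≠ t • (M.map (Int.cast : ℤ → ℚ)) i₀ := by
  classical
  set A := M.map (Int.cast : ℤ → ℚ) with hA
  by_contra hcon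
  push Not at hcon
  have hspan : Submodule.span ℚ (Set.range A.row) ≤ Submodule.span ℚ {A i₀} := by
    refine Submodule.span_le.2 ?_
    rintro _ ⟨i, rfl⟩
    obtain ⟨t, ht⟩ := hcon i
    change A i ∈ (Submodule.span ℚ ({A i₀} : Set (Fin n → ℚ)) : Set (Fin n → ℚ))
    rw [ht]
    exact (Submodule.span ℚ ({A i₀} : Set (Fin n → ℚ))).smul_mem t
      (Submodule.subset_span (Set.mem_singleton _))
  have h1 : Module.finrank ℚ (Submodule.span ℚ ({A i₀} : Set (Fin n → ℚ))) ≤ 1 := by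
    have := finrank_span_le_card (R := ℚ) ({A i₀} : Set (Fin n → ℚ))
    rwa [Set.toFinset_singleton, Finset.card_singleton] at this
  have h2 := Submodule.finrank_mono hspan
  rw [← Matrix.rank_eq_finrank_span_row] at h2
  omega

/-- Two plane vectors with vanishing determinant, the first nonzero, are proportional. [folklore] -/
theorem exists_smul_of_det_two_eq_zero {v w : Fin 2 → ℚ} (hv : v ≠ 0)
    (h : v 0 * w 1 - v 1 * w 0 = 0) : ∃ t : ℚ, w = t • v := by
  have key : ∀ t : ℚ, w 0 = t * v 0 → w 1 = t * v 1 → ∃ t : ℚ, w = t • v := by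
    intro t ht0 ht1
    refine ⟨t, funext fun k => ?_⟩
    fin_cases k
    · simpa using ht0
    · simpa using ht1
  by_cases h0 : v 0 = 0
  · have h1 : v 1 ≠ 0 := by
      intro h1
      apply hv
      funext k
      fin_cases k
      · exact h0
      · exact h1
    have hw0 : w 0 = 0 := by
      rw [h0, zero_mul, zero_sub, neg_eq_zero] at h
      exact (mul_eq_zero.1 h).resolve_left h1
    refine key (w 1 / v 1) ?_ ?_
    · rw [hw0, h0, mul_zero]
    · rw [div_mul_cancel₀ _ h1]
  · refine key (w 0 / v 0) ?_ ?_
    · rw [div_mul_cancel₀ _ h0]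
    · rw [div_mul_eq_mul_div, eq_div_iff h0]
      linear_combination h

/-! ## Two field-theoretic tools -/

/-- **Pairs**: `{a, b}` is algebraically independent over `F` when `a` is transcendental over `F` and
`b` is transcendental over `F[a]`. [folklore] -/
theorem algebraicIndependent_pair {F E : Type*} [Field F] [Field E] [Algebra F E] {a b : E}
    (ha : Transcendental F a) (hb : Transcendental (Algebra.adjoin F (Set.range ![a])) b) :
    AlgebraicIndependent F ![a, b] := by
  have h1 : AlgebraicIndependent F ![a] := algebraicIndependent_iff_transcendental.2 ha
  have h2 : AlgebraicIndependent F (fun o : Option (Fin 1) => o.elim b ![a]) :=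
    AlgebraicIndependent.option_iff.2 ⟨h1, hb⟩
  have hinj : Function.Injective (![some 0, none] : Fin 2 → Option (Fin 1)) := by
    intro i j hij
    fin_cases i <;> fin_cases j <;> simp_all
  have h3 := h2.comp _ hinj
  convert h3 using 1
  funext k
  fin_cases k <;> rfl

/-- **`r + c·u` is transcendental over `R`** for `r ∈ R`, `c ∈ F^×` and `u` transcendental over the
subalgebra `R` of a field. [folklore] -/
theorem transcendental_add_mul_of_transcendental {F E : Type*} [Field F] [Field E] [Algebra F E]
    {R : Subalgebra F E} {r u : E} (hr : r ∈ R) {c : F} (hc : c ≠ 0)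
    (hu : Transcendental R u) : Transcendental R (r + algebraMap F E c * u) := by
  intro halg
  apply hu
  have hr' : IsAlgebraic R r := isAlgebraic_algebraMap (⟨r, hr⟩ : R)
  have hc' : IsAlgebraic R (algebraMap F E c⁻¹) := by
    have : algebraMap F E c⁻¹ = algebraMap R E (algebraMap F R c⁻¹) :=
      (IsScalarTower.algebraMap_apply F R E _)
    rw [this]
    exact isAlgebraic_algebraMap _
  have h1 : IsAlgebraic R (algebraMap F E c * u) := by
    have := halg.sub hr'
    rwa [add_sub_cancel_left] at this
  have h2 := hc'.mul h1
  rwa [← mul_assoc, ← map_mul, inv_mul_cancel₀ hc, map_one, one_mul] at h2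


/-! ## Rank bookkeeping over `ℚ`, II: rows with vanishing last entry (for the general lift) -/

section RankRows

variable {n : ℕ}

/-- Rows with vanishing last entry: the rank of the matrix of their first `n` entries is the
dimension of their span. [folklore] -/
theorem finrank_span_range_eq_rank_truncate (w : Fin n → Fin (n + 1) → ℚ)
    (hw : ∀ k, w k (Fin.last n) = 0) :
    Module.finrank ℚ (Submodule.span ℚ (Set.range w)) =
      (Matrix.of fun k j => w k (Fin.castSucc j) : Matrix (Fin n) (Fin n) ℚ).rank := by
  classical
  -- the zero-padding `ψ : ℚⁿ → ℚⁿ⁺¹`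
  let ψ : (Fin n → ℚ) →ₗ[ℚ] (Fin (n + 1) → ℚ) :=
    { toFun := fun v => Fin.snoc v 0
      map_add' := fun v v' => by
        funext j
        rcases Fin.eq_castSucc_or_eq_last j with ⟨i, rfl⟩ | rfl
        · simp only [Fin.snoc_castSucc, Pi.add_apply]
        · simp only [Fin.snoc_last, Pi.add_apply, add_zero]
      map_smul' := fun c v => by
        funext j
        rcases Fin.eq_castSucc_or_eq_last j with ⟨i, rfl⟩ | rfl
        · simp only [Fin.snoc_castSucc, Pi.smul_apply, RingHom.id_apply]
        · simp only [Fin.snoc_last, Pi.smul_apply, smul_zero, RingHom.id_apply] }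
  have hψ : Function.Injective ψ := by
    intro v v' h
    funext i
    have := congrFun h (Fin.castSucc i)
    simpa only [ψ, LinearMap.coe_mk, AddHom.coe_mk, Fin.snoc_castSucc] using this
  set N : Matrix (Fin n) (Fin n) ℚ := Matrix.of fun k j => w k (Fin.castSucc j) with hN
  have hrow : ∀ k, ψ (N.row k) = w k := by
    intro k
    funext j
    rcases Fin.eq_castSucc_or_eq_last j with ⟨i, rfl⟩ | rfl
    · simp only [ψ, LinearMap.coe_mk, AddHom.coe_mk, Fin.snoc_castSucc]
      rfl
    · simp only [ψ, LinearMap.coe_mk, AddHom.coe_mk, Fin.snoc_last, hw k]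
  have hcomp : (ψ : (Fin n → ℚ) → (Fin (n + 1) → ℚ)) ∘ N.row = w := funext hrow
  have hspan : Submodule.span ℚ (Set.range w) = (Submodule.span ℚ (Set.range N.row)).map ψ := by
    rw [Submodule.map_span, ← Set.range_comp, hcomp]
  rw [Matrix.rank_eq_finrank_span_row, hspan]
  exact ((Submodule.equivMapOfInjective ψ hψ _).finrank_eq).symm

/-- The span of a singleton has dimension `≤ 1`. [folklore] -/
theorem finrank_span_singleton_le_one (v : Fin (n + 1) → ℚ) :
    Module.finrank ℚ (Submodule.span ℚ ({v} : Set (Fin (n + 1) → ℚ))) ≤ 1 := by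
  classical
  have := finrank_span_le_card (R := ℚ) ({v} : Set (Fin (n + 1) → ℚ))
  rwa [Set.toFinset_singleton, Finset.card_singleton] at this

/-- A square matrix of rank `< n + 1` has a row in the span of the others. [folklore] -/
theorem exists_row_mem_span_of_rank_lt (A : Matrix (Fin (n + 1)) (Fin (n + 1)) ℚ)
    (h : A.rank < n + 1) :
    ∃ i, A i ∈ Submodule.span ℚ (Set.range (A ∘ Fin.succAbove i)) := by
  classical
  by_contra hcon
  push Not at hcon
  have hind : LinearIndependent ℚ A.row := by
    rw [linearIndependent_iff_notMem_span]
    intro i hi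
    apply hcon i
    have : A.row '' (Set.univ \ {i}) = Set.range (A ∘ Fin.succAbove i) := by
      rw [Set.range_comp, Fin.range_succAbove, Set.compl_eq_univ_sdiff]
      rfl
    rwa [this] at hi
  have := hind.rank_matrix
  rw [Fintype.card_fin] at this
  omega

/-- The rows of `A` lie in the span of `A i₀` and the rows `A (σ k)`, `σ = succAbove i₀`. [folklore] -/
theorem rank_le_finrank_span_insert (A : Matrix (Fin (n + 1)) (Fin (n + 1)) ℚ) (i₀ : Fin (n + 1))
    (T : Submodule ℚ (Fin (n + 1) → ℚ)) (h₀ : A i₀ ∈ T) (hσ : ∀ k, A (Fin.succAbove i₀ k) ∈ T) :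
    A.rank ≤ Module.finrank ℚ T := by
  classical
  rw [Matrix.rank_eq_finrank_span_row]
  refine Submodule.finrank_mono (Submodule.span_le.2 ?_)
  rintro _ ⟨j, rfl⟩
  by_cases hj : j = i₀
  · rw [hj]; exact h₀
  · obtain ⟨k, rfl⟩ := Fin.exists_succAbove_eq hj
    exact hσ k

end RankRows

/-! ## Coordinates of `[M] z` when the last column of `M` vanishes at a row -/

/-- Additive coordinate of `[M] z` at a row with vanishing last entry. [folklore] -/
theorem matrixAct_inl_of_last_eq_zero {K : Type*} [Field K] {n : ℕ}
    (M : Matrix (Fin (n + 1)) (Fin (n + 1)) ℤ) (z : Fin (n + 1) ⊕ Fin (n + 1) → K) {i : Fin (n + 1)}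
    (h : M i (Fin.last n) = 0) :
    matrixAct M z (Sum.inl i) =
      ∑ j : Fin n, (M i (Fin.castSucc j) : K) * z (Sum.inl (Fin.castSucc j)) := by
  rw [matrixAct_inl, Fin.sum_univ_castSucc, h, Int.cast_zero, zero_mul, add_zero]

/-- Multiplicative coordinate of `[M] z` at a row with vanishing last entry. [folklore] -/
theorem matrixAct_inr_of_last_eq_zero {K : Type*} [Field K] {n : ℕ}
    (M : Matrix (Fin (n + 1)) (Fin (n + 1)) ℤ) (z : Fin (n + 1) ⊕ Fin (n + 1) → K) {i : Fin (n + 1)}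
    (h : M i (Fin.last n) = 0) :
    matrixAct M z (Sum.inr i) = ∏ j : Fin n, z (Sum.inr (Fin.castSucc j)) ^ M i (Fin.castSucc j) := by
  rw [matrixAct_inr, Fin.prod_univ_castSucc, h, zpow_zero, mul_one]

/-- When the last column of `M ∈ M_{n+1}(ℤ)` vanishes, the coordinates of `[N] z_S` — `N` the matrix
of the rows `succAbove i_d k` of `M` (first `n` columns), `z_S` the small coordinates of `z` — are
coordinates of `[M] z`. [folklore] -/
theorem matrixAct_rows_eq_of_last_col_zero {K : Type*} [Field K] {n : ℕ}
    (M : Matrix (Fin (n + 1)) (Fin (n + 1)) ℤ) (hcol : ∀ i, M i (Fin.last n) = 0)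
    (z : Fin (n + 1) ⊕ Fin (n + 1) → K) (zS : Fin n ⊕ Fin n → K)
    (hzS : ∀ t, zS t = z (Sum.map Fin.castSucc Fin.castSucc t)) (i_d : Fin (n + 1))
    (j : Fin n ⊕ Fin n) :
    matrixAct (Matrix.of fun k j => M (Fin.succAbove i_d k) (Fin.castSucc j)) zS j =
      matrixAct M z (Sum.map (Fin.succAbove i_d) (Fin.succAbove i_d) j) := by
  rcases j with k | k
  · rw [Sum.map_inl, matrixAct_inl_of_last_eq_zero M z (hcol _), matrixAct_inl]
    refine Finset.sum_congr rfl fun j _ => ?_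
    rw [Matrix.of_apply, hzS]
    rfl
  · rw [Sum.map_inr, matrixAct_inr_of_last_eq_zero M z (hcol _), matrixAct_inr]
    refine Finset.prod_congr rfl fun j _ => ?_
    rw [Matrix.of_apply, hzS]
    rfl

/-! ## A transcendence-degree step and an exponent bookkeeping -/

/-- `trdeg F[S] + 1 ≤ trdeg F[S ∪ {u}]` for `u` transcendental over `F[S]` (variant of
`trdeg_adjoin_add_one_le` with the big field replaced by the subalgebra generated). [folklore] -/
theorem trdeg_adjoin_add_one_le_trdeg_adjoin_insert {F K : Type*} [Field F] [Field K]
    [Algebra F K] (S : Set K) {u : K} (hu : Transcendental (Algebra.adjoin F S) u) :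
    Algebra.trdeg F (Algebra.adjoin F S) + 1 ≤ Algebra.trdeg F (Algebra.adjoin F (insert u S)) := by
  set A := Algebra.adjoin F S with hA
  set B := Algebra.adjoin F (insert u S) with hB
  haveI : FaithfulSMul F A := (faithfulSMul_iff_algebraMap_injective F A).2 (algebraMap F A).injective
  obtain ⟨s, hs⟩ := exists_isTranscendenceBasis F A
  have hind : AlgebraicIndependent F (fun i : s => ((i : A) : K)) :=
    hs.1.map' (f := A.val) Subtype.val_injective
  have hsub : Set.range (fun i : s => ((i : A) : K)) ⊆ (A : Set K) := by
    rintro _ ⟨i, rfl⟩; exact (i : A).2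
  have hle : Algebra.adjoin F (Set.range fun i : s => ((i : A) : K)) ≤ A := Algebra.adjoin_le hsub
  have hopt : AlgebraicIndependent F (fun o : Option s => o.elim u fun i : s => ((i : A) : K)) :=
    AlgebraicIndependent.option_iff.2 ⟨hind, hu.of_tower_top_of_subalgebra_le hle⟩
  have hAB : A ≤ B := Algebra.adjoin_mono (Set.subset_insert _ _)
  have hmemB : ∀ o : Option s, (o.elim u fun i : s => ((i : A) : K)) ∈ B := by
    rintro (_ | i)
    · exact Algebra.subset_adjoin (Set.mem_insert _ _)
    · exact hAB (i : A).2
  let w : Option s → B := fun o => ⟨_, hmemB o⟩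
  have hw : AlgebraicIndependent F w := AlgebraicIndependent.of_comp B.val hopt
  have h1 := hw.cardinalMk_le_trdeg
  rw [Cardinal.mk_option, hs.cardinalMk_eq_trdeg] at h1
  exact h1

/-- Integer bookkeeping: `z · m₀^{c} = m₁^{c'}` (all `zpow`) gives `z¹ · (m₀^{c⁺} m₁^{c'⁻}) = m₁^{c'⁺} m₀^{c⁻}`
with natural exponents. [folklore] -/
theorem pow_one_mul_eq_of_mul_zpow_eq {K : Type*} [Field K] {z m₀ m₁ : K} (h₀ : m₀ ≠ 0) (h₁ : m₁ ≠ 0)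
    {c c' : ℤ} (h : z * m₀ ^ c = m₁ ^ c') :
    z ^ 1 * (m₀ ^ c.toNat * m₁ ^ (-c').toNat) = m₁ ^ c'.toNat * m₀ ^ (-c).toNat := by
  have hc : (c.toNat : ℤ) = c + (-c).toNat := by have := Int.toNat_sub_toNat_neg c; omega
  have hc' : (c'.toNat : ℤ) = c' + (-c').toNat := by have := Int.toNat_sub_toNat_neg c'; omega
  rw [pow_one, ← zpow_natCast m₀ c.toNat, hc, zpow_add₀ h₀, ← zpow_natCast m₁ c'.toNat, hc',
    zpow_add₀ h₁, zpow_natCast, zpow_natCast]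
  calc z * (m₀ ^ c * m₀ ^ (-c).toNat * m₁ ^ (-c').toNat)
      = (z * m₀ ^ c) * (m₀ ^ (-c).toNat * m₁ ^ (-c').toNat) := by ring
    _ = m₁ ^ c' * m₁ ^ (-c').toNat * m₀ ^ (-c).toNat := by rw [h]; ring

end Summit.Schanuel.Schanuel.Theorems
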